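import Summits.ResolutionOfSingularities.ResolutionOfSingularities.Theorems.MarkedTransferCampaignW13RFlatArcCriterion
import Summits.ResolutionOfSingularities.ResolutionOfSingularities.Theorems.MarkedTransferCampaignW13RFlatCanonicalPosSurface
import HarnessLib

/-!
# [OURS · L1 W1.3] The rung-1 content Prop on `𝒞_can` FAILS IN ODD CHARACTERISTIC too: `p = 3`, head
# `u³ + z³·(xy² + xyz + xz² + y²z + yz²)`, arc `(t, −t, −t, t²)` inside the order-`3` locus (seat res-L1-s13-pv-1, g2)

LADDER-RESOLUTION rung L (rescue), cell `res-hironaka`, RESCUE-SEED slot W1.3 (architecture bypass, reading R-flat), F7′ row 1.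
p501051 / p503083 refuted o2's `Campaign.CampaignW13RFlatCanonicalPos` at `p = 2`. This file answers «is it a
characteristic-2 phenomenon?» — NO. `K` any field of characteristic `3`, `O = K[x,y,z,u]` (`X 0, X 1, X 2, X 3`), `q = p = 3`,
`e = 1`, head `g = u³ + ε` with `ε = z³·Q`, `Q = xy² + xyz + xz² + y²z + yz²` (so `ε = xy²z³ + xyz⁴ + xz⁵ + y²z⁴ + yz⁵`:
free of `u`, NO monomial with all exponents divisible by `3`, `ord₀ ε = 6 > q`): the datum (`e = 1`, tail `u`, `r = 0`) IS
CANONICAL (`P3_isCanonicalChain`). The cubic `Q` has, at `c = (1,−1,−1)`, `Q(c) = 1 ≠ 0` while ALL Hasse derivatives of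
orders `1` and `2` vanish at `c` (found by the seat's linear-algebra search over `𝔽₃`; the count in two variables forbids this,
three variables allow it). Consequently along the arc `γ(t) = (t, −t, −t, t²)`: `g(γ + v) = v₃³ − t³·Q(v) + t³·v₂³ + v₂³·Q(v)
∈ (v)³` in `K[t][v]` (`P3_taylor`, `P3_taylor_mem`: cofactor identity `LHS − RHS = 3·W`), i.e. `φ(D^{(α)}g) = 0` for every
`|α| ≤ 2` — THE ARC LIES IN THE ORDER-`3` LOCUS `top(g, 3)` — while `u³∘γ = t⁶ ≠ 0`. By the general arc criterion (p506602
`W13.not_mem_pAlgPiece_one_of_singArc_general`, EGA IV₄ 16.11.2 + Huneke–Swanson): `u³ ∉ ℘_alg(((g),3),1)`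
(`P3_tail_cube_not_mem`), also `s·u³ ∉ ℘` for `s(0) ≠ 0` (`P3_mul_tail_cube_not_mem`), `¬ RFlatTailPow 3 …`, and
**`¬ CampaignW13RFlatCanonicalPos 3 K (3 : Fin 4)`** (`Campaign.not_CampaignW13RFlatCanonicalPos_three`).

Reading (prover's words; AI bookkeeping weaker than expert review): the R-flat rung-1 feed fails on the canonical class in
characteristic `3` by the same mechanism as at `p = 2` (a curve of the top locus through `ξ` on which the coordinate-bound
canonical tail does not vanish); the «large `p`» regime offers no refuge for the coordinate-bound class. Caveat of record:
nothing here bears on L-G4 / (127).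

HONEST FRAMING. OURS statements about the OURS bypass objects (bound algebraic `℘`, row 003 U17_2; candidate U17_4 not used);
nothing here is a statement of H. Hironaka's manuscript [Hironaka2017] (2017-03-23, lit key `paper:url-3343fd9e678b`); no claim
about resolution of singularities in positive characteristic. All decls `[folklore]`, sorry-free.
-/

noncomputable section

set_option linter.dupNamespace false -- mandated namespace of this single-conjunct summit

namespace Summit.ResolutionOfSingularities.ResolutionOfSingularities.Theorems.Campaign

open MvPolynomial
open Literature.AlgebraicGeometry.Resolution
open Literature.AlgebraicGeometry.Hironaka2017
open Literature.AlgebraicGeometry.Hironaka2017.S09LLUED (LLChainData)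

namespace W13

/-! ## §0 Support helpers at a general exponent `q` -/

section Helpers

variable (K : Type) [Field K]

/-- Monomial supports: a sum keeps the property «every exponent vector has an entry not divisible by `q`». [folklore] -/
theorem exists_not_dvd_of_mem_support_add {n q : ℕ} {p r : MvPolynomial (Fin n) K}
    (hp : ∀ m ∈ p.support, ∃ i, ¬ q ∣ m i) (hr : ∀ m ∈ r.support, ∃ i, ¬ q ∣ m i) :
    ∀ m ∈ (p + r).support, ∃ i, ¬ q ∣ m i := fun m hm =>
  (Finset.mem_union.mp (support_add hm)).elim (hp m) (hr m)

/-- … and a monomial with an entry not divisible by `q` has it. [folklore] -/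
theorem exists_not_dvd_of_mem_support_monomial {n q : ℕ} (m₀ : Fin n →₀ ℕ) (c : K) (i : Fin n) (hi : ¬ q ∣ m₀ i) :
    ∀ m ∈ (monomial m₀ c : MvPolynomial (Fin n) K).support, ∃ j, ¬ q ∣ m j := fun m hm => by
  rw [Finset.mem_singleton.mp (support_monomial_subset hm)]
  exact ⟨i, hi⟩

end Helpers

/-! ## §1 The head `g = u³ + xy²z³ + xyz⁴ + xz⁵ + y²z⁴ + yz⁵` over a field of characteristic `3` -/

section HeadP3

variable (K : Type) [Field K] [CharP K 3]

/-- **Taylor expansion of `g` along the arc `γ = (t, −t, −t, t²)`** (written with `2 = −1`): in `K[t][v₀,…,v₃]`,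
`g(γ + v) = v₃³ + 2t³·Q(v) + t³·v₂³ + v₂³·Q(v)`, `Q(v) = v₀v₁² + v₀v₁v₂ + v₀v₂² + v₁²v₂ + v₁v₂²` — no terms of `v`-degree
`≤ 2` (the cubic `Q` has `Q(c) = 1` and vanishing first and second Hasse derivatives at `c = (1,2,2)`). Certified by the
cofactor identity `LHS − RHS = 3·W`. [folklore] -/
theorem P3_taylor :
    MvPolynomial.aeval (R := K)
        (fun i => (MvPolynomial.C ((![Polynomial.X, 2 * Polynomial.X, 2 * Polynomial.X, Polynomial.X ^ 2] :
          Fin 4 → Polynomial K) i) : MvPolynomial (Fin 4) (Polynomial K)) + X i)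
        (X 3 ^ 3 + (X 0 * X 1 ^ 2 * X 2 ^ 3 + X 0 * X 1 * X 2 ^ 4 + X 0 * X 2 ^ 5 + X 1 ^ 2 * X 2 ^ 4 + X 1 * X 2 ^ 5) :
          MvPolynomial (Fin 4) K) =
      X 3 ^ 3 + MvPolynomial.C (2 * Polynomial.X ^ 3) *
          (X 0 * X 1 ^ 2 + X 0 * X 1 * X 2 + X 0 * X 2 ^ 2 + X 1 ^ 2 * X 2 + X 1 * X 2 ^ 2) +
        MvPolynomial.C (Polynomial.X ^ 3) * X 2 ^ 3 +
        X 2 ^ 3 * (X 0 * X 1 ^ 2 + X 0 * X 1 * X 2 + X 0 * X 2 ^ 2 + X 1 ^ 2 * X 2 + X 1 * X 2 ^ 2) := by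
  have h3 : (3 : MvPolynomial (Fin 4) (Polynomial K)) = 0 := by
    have := CharP.cast_eq_zero (MvPolynomial (Fin 4) (Polynomial K)) 3
    simpa using this
  simp only [map_add, map_mul, map_pow, MvPolynomial.aeval_X, Matrix.cons_val_zero, Matrix.cons_val_one,
    Matrix.cons_val_two, Matrix.cons_val_three, Matrix.tail_cons, Matrix.head_cons, map_ofNat]
  set t : MvPolynomial (Fin 4) (Polynomial K) := MvPolynomial.C Polynomial.X with ht
  linear_combination (1 * t * X 2 ^ 5 + 5 * t * X 1 * X 2 ^ 4 + 3 * t * X 1 ^ 2 * X 2 ^ 3 + 4 * t * X 0 * X 2 ^ 4 +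
    4 * t * X 0 * X 1 * X 2 ^ 3 + 2 * t * X 0 * X 1 ^ 2 * X 2 ^ 2 + 1 * t ^ 2 * X 3 ^ 2 + 12 * t ^ 2 * X 2 ^ 4 +
    28 * t ^ 2 * X 1 * X 2 ^ 3 + 10 * t ^ 2 * X 1 ^ 2 * X 2 ^ 2 + 20 * t ^ 2 * X 0 * X 2 ^ 3 +
    16 * t ^ 2 * X 0 * X 1 * X 2 ^ 2 + 4 * t ^ 2 * X 0 * X 1 ^ 2 * X 2 + 57 * t ^ 3 * X 2 ^ 3 +
    74 * t ^ 3 * X 1 * X 2 ^ 2 + 14 * t ^ 3 * X 1 ^ 2 * X 2 + 50 * t ^ 3 * X 0 * X 2 ^ 2 + 26 * t ^ 3 * X 0 * X 1 * X 2 +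
    2 * t ^ 3 * X 0 * X 1 ^ 2 + 1 * t ^ 4 * X 3 + 136 * t ^ 4 * X 2 ^ 2 + 96 * t ^ 4 * X 1 * X 2 + 8 * t ^ 4 * X 1 ^ 2 +
    64 * t ^ 4 * X 0 * X 2 + 16 * t ^ 4 * X 0 * X 1 + 160 * t ^ 5 * X 2 + 48 * t ^ 5 * X 1 + 32 * t ^ 5 * X 0 +
    75 * t ^ 6 : MvPolynomial (Fin 4) (Polynomial K)) * h3

omit [CharP K 3] in
/-- The right-hand side lies in `(v)³` (`idealOfVars ^ 3`): every term is a product of at least three `v`'s. [folklore] -/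
theorem P3_taylor_mem :
    (X 3 ^ 3 + MvPolynomial.C (2 * Polynomial.X ^ 3) *
          (X 0 * X 1 ^ 2 + X 0 * X 1 * X 2 + X 0 * X 2 ^ 2 + X 1 ^ 2 * X 2 + X 1 * X 2 ^ 2) +
        MvPolynomial.C (Polynomial.X ^ 3) * X 2 ^ 3 +
        X 2 ^ 3 * (X 0 * X 1 ^ 2 + X 0 * X 1 * X 2 + X 0 * X 2 ^ 2 + X 1 ^ 2 * X 2 + X 1 * X 2 ^ 2) :
          MvPolynomial (Fin 4) (Polynomial K)) ∈ idealOfVars (Fin 4) (Polynomial K) ^ 3 := by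
  have hX : ∀ i : Fin 4, (X i : MvPolynomial (Fin 4) (Polynomial K)) ∈ idealOfVars (Fin 4) (Polynomial K) :=
    fun i => Ideal.subset_span (Set.mem_range_self i)
  have h3 : ∀ a b c : Fin 4, (X a * X b * X c : MvPolynomial (Fin 4) (Polynomial K)) ∈
      idealOfVars (Fin 4) (Polynomial K) ^ 3 := by
    intro a b c
    rw [pow_succ, pow_two]
    exact Ideal.mul_mem_mul (Ideal.mul_mem_mul (hX a) (hX b)) (hX c)
  have hcube : ∀ i : Fin 4, (X i ^ 3 : MvPolynomial (Fin 4) (Polynomial K)) ∈ idealOfVars (Fin 4) (Polynomial K) ^ 3 :=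
    fun i => Ideal.pow_mem_pow (hX i) 3
  have hQ : (X 0 * X 1 ^ 2 + X 0 * X 1 * X 2 + X 0 * X 2 ^ 2 + X 1 ^ 2 * X 2 + X 1 * X 2 ^ 2 :
      MvPolynomial (Fin 4) (Polynomial K)) ∈ idealOfVars (Fin 4) (Polynomial K) ^ 3 := by
    have e1 : (X 0 * X 1 ^ 2 : MvPolynomial (Fin 4) (Polynomial K)) = X 0 * X 1 * X 1 := by ring
    have e2 : (X 0 * X 2 ^ 2 : MvPolynomial (Fin 4) (Polynomial K)) = X 0 * X 2 * X 2 := by ring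
    have e3 : (X 1 ^ 2 * X 2 : MvPolynomial (Fin 4) (Polynomial K)) = X 1 * X 1 * X 2 := by ring
    have e4 : (X 1 * X 2 ^ 2 : MvPolynomial (Fin 4) (Polynomial K)) = X 1 * X 2 * X 2 := by ring
    rw [e1, e2, e3, e4]
    exact Ideal.add_mem _ (Ideal.add_mem _ (Ideal.add_mem _ (Ideal.add_mem _ (h3 0 1 1) (h3 0 1 2)) (h3 0 2 2))
      (h3 1 1 2)) (h3 1 2 2)
  refine Ideal.add_mem _ (Ideal.add_mem _ (Ideal.add_mem _ (hcube 3) (Ideal.mul_mem_left _ _ hQ))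
    (Ideal.mul_mem_left _ _ (hcube 2))) ?_
  exact Ideal.mul_mem_left _ _ hQ

/-- **The arc lies in the order-`3` locus of `g`**: `φ(D^{(α)}g) = 0` for every Hasse multi-index `α` with `|α| ≤ 2`,
`φ = ` evaluation along `γ = (t, −t, −t, t²)` (p506602 `aeval_hasseDeriv_eq_zero_of_mem_pow`). [folklore] -/
theorem P3_arc_hasseDeriv_eq_zero :
    ∀ α : Fin 4 →₀ ℕ, α.degree < 3 →
      MvPolynomial.aeval ![(Polynomial.X : Polynomial K), 2 * Polynomial.X, 2 * Polynomial.X, Polynomial.X ^ 2]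
        (hasseDeriv K α
          (X 3 ^ 3 + (X 0 * X 1 ^ 2 * X 2 ^ 3 + X 0 * X 1 * X 2 ^ 4 + X 0 * X 2 ^ 5 + X 1 ^ 2 * X 2 ^ 4 + X 1 * X 2 ^ 5) :
            MvPolynomial (Fin 4) K)) = 0 := by
  refine aeval_hasseDeriv_eq_zero_of_mem_pow K _ _ 3 ?_
  rw [P3_taylor K]
  exact P3_taylor_mem K

omit [CharP K 3] in
/-- Along the arc: `u³∘γ = t⁶ ≠ 0`. [folklore] -/
theorem P3_aeval_tail_cube :
    MvPolynomial.aeval ![(Polynomial.X : Polynomial K), 2 * Polynomial.X, 2 * Polynomial.X, Polynomial.X ^ 2]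
        (X 3 ^ 3 : MvPolynomial (Fin 4) K) = Polynomial.X ^ 6 ∧ (Polynomial.X ^ 6 : Polynomial K) ≠ 0 := by
  refine ⟨?_, pow_ne_zero _ Polynomial.X_ne_zero⟩
  simp only [map_pow, MvPolynomial.aeval_X, Matrix.cons_val_three, Matrix.tail_cons, Matrix.head_cons]
  ring

/-- **`u³ ∉ ℘_alg(((g),3),1)`** for the head `g = u³ + z³(xy² + xyz + xz² + y²z + yz²)`, `char K = 3`, bound algebraic `℘`
(degree-1 piece of the integral closure of `O[⊕_{j<3} Diff^{(j)}((g))·X^{3−j}]`): general singular-arc criterion p506602 along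
`(t, −t, −t, t²)`. [folklore] -/
theorem P3_tail_cube_not_mem :
    (X 3 : MvPolynomial (Fin 4) K) ^ 3 ∉
      Campaign.pAlgPiece K (Ideal.span {(X 3 ^ 3 + (X 0 * X 1 ^ 2 * X 2 ^ 3 + X 0 * X 1 * X 2 ^ 4 + X 0 * X 2 ^ 5 +
        X 1 ^ 2 * X 2 ^ 4 + X 1 * X 2 ^ 5) : MvPolynomial (Fin 4) K)}) 3 1 := by
  classical
  refine not_mem_pAlgPiece_one_of_singArc_general K
    (MvPolynomial.aeval ![(Polynomial.X : Polynomial K), 2 * Polynomial.X, 2 * Polynomial.X, Polynomial.X ^ 2]).toRingHom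
    _ 3 (fun α hα => P3_arc_hasseDeriv_eq_zero K α hα) ?_
  change MvPolynomial.aeval _ (X 3 ^ 3 : MvPolynomial (Fin 4) K) ≠ 0
  rw [(P3_aeval_tail_cube K).1]
  exact (P3_aeval_tail_cube K).2

/-- **Stalk-level form**: `s·u³ ∉ ℘_alg(((g),3),1)` for every `s` with `s(0) ≠ 0` — the arc passes through the origin.
[folklore] -/
theorem P3_mul_tail_cube_not_mem (s : MvPolynomial (Fin 4) K) (hs : coeff 0 s ≠ 0) :
    s * X 3 ^ 3 ∉
      Campaign.pAlgPiece K (Ideal.span {(X 3 ^ 3 + (X 0 * X 1 ^ 2 * X 2 ^ 3 + X 0 * X 1 * X 2 ^ 4 + X 0 * X 2 ^ 5 +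
        X 1 ^ 2 * X 2 ^ 4 + X 1 * X 2 ^ 5) : MvPolynomial (Fin 4) K)}) 3 1 := by
  classical
  have hf : ∀ i, ((![(Polynomial.X : Polynomial K), 2 * Polynomial.X, 2 * Polynomial.X, Polynomial.X ^ 2]) i).coeff
      0 = 0 := by
    intro i
    fin_cases i <;> simp [Polynomial.coeff_X_pow]
  refine not_mem_pAlgPiece_one_of_singArc_general K
    (MvPolynomial.aeval ![(Polynomial.X : Polynomial K), 2 * Polynomial.X, 2 * Polynomial.X, Polynomial.X ^ 2]).toRingHom
    _ 3 (fun α hα => P3_arc_hasseDeriv_eq_zero K α hα) ?_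
  change MvPolynomial.aeval _ (s * X 3 ^ 3 : MvPolynomial (Fin 4) K) ≠ 0
  have h0 : MvPolynomial.aeval ![(Polynomial.X : Polynomial K), 2 * Polynomial.X, 2 * Polynomial.X,
      Polynomial.X ^ 2] s ≠ 0 := by
    intro h
    have h1 := coeff_zero_aeval_of_coeff_zero K _ hf s
    rw [h, Polynomial.coeff_zero] at h1
    exact hs h1.symm
  rw [map_mul, (P3_aeval_tail_cube K).1]
  exact mul_ne_zero h0 (P3_aeval_tail_cube K).2

omit [CharP K 3] in
/-- **The datum is CANONICAL at `q = 3`**: head `u³ + ε`, `e = 1`, tail `u`, `r = 0`; `ε = xy²z³ + xyz⁴ + xz⁵ + y²z⁴ + yz⁵`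
is free of `u` and each monomial has an exponent not divisible by `3` (`x¹` in the first three, `y²`, `y¹`); `ord ε = 6 > q`.
[folklore] -/
theorem P3_isCanonicalChain (d : LLChainData (MvPolynomial (Fin 4) K))
    (hdg : d.g 0 = X 3 ^ 3 + (X 0 * X 1 ^ 2 * X 2 ^ 3 + X 0 * X 1 * X 2 ^ 4 + X 0 * X 2 ^ 5 + X 1 ^ 2 * X 2 ^ 4 +
      X 1 * X 2 ^ 5)) (hde : d.e = 1) (hdt : d.tail = X 3) :
    IsCanonicalChain 3 K (3 : Fin 4) d := by
  have hx : ∀ i : Fin 4, i ≠ 3 → (X i : MvPolynomial (Fin 4) K) ∈ supported K ({3}ᶜ : Set (Fin 4)) :=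
    fun i hi => (X_mem_supported (R := K)).mpr hi
  have h0 := hx 0 (by decide)
  have h1 := hx 1 (by decide)
  have h2 := hx 2 (by decide)
  refine ⟨X 0 * X 1 ^ 2 * X 2 ^ 3 + X 0 * X 1 * X 2 ^ 4 + X 0 * X 2 ^ 5 + X 1 ^ 2 * X 2 ^ 4 + X 1 * X 2 ^ 5, 0, ?_,
    by simp, ?_, by rw [hdt, add_zero], ?_⟩
  · exact not_mem_vars_of_mem_supported (add_mem (add_mem (add_mem (add_mem
      (mul_mem (mul_mem h0 (pow_mem h1 2)) (pow_mem h2 3)) (mul_mem (mul_mem h0 h1) (pow_mem h2 4)))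
      (mul_mem h0 (pow_mem h2 5))) (mul_mem (pow_mem h1 2) (pow_mem h2 4))) (mul_mem h1 (pow_mem h2 5)))
  · rw [hdg, hde, pow_one]
  · rw [hde, pow_one, zero_pow three_ne_zero, sub_zero, X_pow_eq_monomial, X_pow_eq_monomial, X_pow_eq_monomial,
      X_pow_eq_monomial, X, X]
    simp only [monomial_mul]
    refine exists_not_dvd_of_mem_support_add K (exists_not_dvd_of_mem_support_add K
      (exists_not_dvd_of_mem_support_add K (exists_not_dvd_of_mem_support_add K ?_ ?_) ?_) ?_) ?_
    · exact exists_not_dvd_of_mem_support_monomial K _ _ 0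
        (by simp only [Finsupp.add_apply, Finsupp.single_apply]; decide)
    · exact exists_not_dvd_of_mem_support_monomial K _ _ 0
        (by simp only [Finsupp.add_apply, Finsupp.single_apply]; decide)
    · exact exists_not_dvd_of_mem_support_monomial K _ _ 0
        (by simp only [Finsupp.add_apply, Finsupp.single_apply]; decide)
    · exact exists_not_dvd_of_mem_support_monomial K _ _ 1
        (by simp only [Finsupp.add_apply, Finsupp.single_apply]; decide)
    · exact exists_not_dvd_of_mem_support_monomial K _ _ 1
        (by simp only [Finsupp.add_apply, Finsupp.single_apply]; decide)

/-- **`¬ RFlatTailPow 3`** (v4 schema) for every chain datum on this head with `e = 1` and the canonical tail `u`.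
[folklore] -/
theorem P3_not_rFlatTailPow (d : LLChainData (MvPolynomial (Fin 4) K))
    (hdg : d.g 0 = X 3 ^ 3 + (X 0 * X 1 ^ 2 * X 2 ^ 3 + X 0 * X 1 * X 2 ^ 4 + X 0 * X 2 ^ 5 + X 1 ^ 2 * X 2 ^ 4 +
      X 1 * X 2 ^ 5)) (hde : d.e = 1) (hdt : d.tail = X 3) :
    ¬ Campaign.RFlatTailPow 3 K (Ideal.span {d.g 0}) (3 ^ d.e) d := by
  rw [Campaign.RFlatTailPow, hdg, hde, hdt, pow_one]
  exact P3_tail_cube_not_mem K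

end HeadP3

end W13

/-! ## §2 The content Prop fails at `p = 3` -/

section HeadlineP3

/-- **REFUTATION of `Campaign.CampaignW13RFlatCanonicalPos 3 K (3 : Fin 4)`** over every field of characteristic `3`
(chart `K[x,y,z,u]`, tail variable `u`): the canonical datum on `u³ + z³(xy² + xyz + xz² + y²z + yz²)` violates
`RFlatTailPow` (`W13.P3_not_rFlatTailPow`). The R-flat rung-1 failure on `𝒞_can` is NOT a characteristic-`2` phenomenon.
[folklore] -/
theorem not_CampaignW13RFlatCanonicalPos_three (K : Type) [Field K] [CharP K 3] :
    ¬ CampaignW13RFlatCanonicalPos 3 K (3 : Fin 4) := by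
  intro h
  have key : ∀ d : LLChainData (MvPolynomial (Fin 4) K),
      d.g 0 = X 3 ^ 3 + (X 0 * X 1 ^ 2 * X 2 ^ 3 + X 0 * X 1 * X 2 ^ 4 + X 0 * X 2 ^ 5 + X 1 ^ 2 * X 2 ^ 4 +
        X 1 * X 2 ^ 5) → d.e = 1 → d.tail = X 3 → False :=
    fun d hdg hde hdt => W13.P3_not_rFlatTailPow K d hdg hde hdt (h d (W13.P3_isCanonicalChain K d hdg hde hdt))
  exact key ⟨1, fun _ => X 3,
      fun j => if j = 0 then X 3 ^ 3 + (X 0 * X 1 ^ 2 * X 2 ^ 3 + X 0 * X 1 * X 2 ^ 4 + X 0 * X 2 ^ 5 +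
        X 1 ^ 2 * X 2 ^ 4 + X 1 * X 2 ^ 5) else X 3,
      fun _ => X 0 * X 1 ^ 2 * X 2 ^ 3 + X 0 * X 1 * X 2 ^ 4 + X 0 * X 2 ^ 5 + X 1 ^ 2 * X 2 ^ 4 + X 1 * X 2 ^ 5,
      fun _ => 0, fun _ => 6⟩
    (by show (if (0 : ℕ) = 0 then X 3 ^ 3 + (X 0 * X 1 ^ 2 * X 2 ^ 3 + X 0 * X 1 * X 2 ^ 4 + X 0 * X 2 ^ 5 +
          X 1 ^ 2 * X 2 ^ 4 + X 1 * X 2 ^ 5) else (X 3 : MvPolynomial (Fin 4) K)) =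
          X 3 ^ 3 + (X 0 * X 1 ^ 2 * X 2 ^ 3 + X 0 * X 1 * X 2 ^ 4 + X 0 * X 2 ^ 5 + X 1 ^ 2 * X 2 ^ 4 + X 1 * X 2 ^ 5)
        exact if_pos rfl)
    rfl
    (by show (if (1 : ℕ) = 0 then X 3 ^ 3 + (X 0 * X 1 ^ 2 * X 2 ^ 3 + X 0 * X 1 * X 2 ^ 4 + X 0 * X 2 ^ 5 +
          X 1 ^ 2 * X 2 ^ 4 + X 1 * X 2 ^ 5) else (X 3 : MvPolynomial (Fin 4) K)) = X 3
        exact if_neg one_ne_zero)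

/-- The `𝔽₃` instance. [folklore] -/
theorem not_CampaignW13RFlatCanonicalPos_three_zmod3 : ¬ CampaignW13RFlatCanonicalPos 3 (ZMod 3) (3 : Fin 4) :=
  haveI : Fact (Nat.Prime 3) := ⟨Nat.prime_three⟩
  not_CampaignW13RFlatCanonicalPos_three (ZMod 3)

end HeadlineP3

end Summit.ResolutionOfSingularities.ResolutionOfSingularities.Theorems.Campaign

end
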